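import Literature.IUT.LogVolume.LocalFieldVolume
import HarnessLib

/-!
# The two factors of the (Ξ1^non) witness over a residue field `𝔽₂` (volumes `8/9` and `27/32`)

Ingredients for the model-level kernel witness `Xi1ModelNegative.lean` against [IUTchIII] Rmk. 3.9.5
(iv) (Ξ1^non) (kurims p. 128) with unequal weights, over ONE nonarchimedean local field `K` (norm
presentation, volume `μ_K` of [AbsTopIII] Prop. 5.7 (i) normalised by `μ_K(O_K) = 1` as in
`LocalFieldVolume.lean`) whose residue field has cardinality `2`:

* `isCompact_selfSimilar_and_one_mem`, `localVolume_real_selfSimilar` — the compact, NON-open set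
  `A₀ = O ∖ {‖x‖ = ‖ϖ‖ⁿ : n ≡ 3,4,5 (mod 6)}` contains `1` and has `μ(A₀) = 8/9`, by the self-similarity
  `A₀ = (O ∖ m³) ⊔ ϖ⁶·A₀` and `μ(ϖ⁶·S) = 2⁻⁶·μ(S)` (Prop. 5.7 (i)(b)) — no infinite sums needed;
* `localVolume_real_puncturedBall` — `A₁ = O ∖ ({‖x‖ = ‖ϖ‖²} ∪ m⁵)` is compact, contains `1`, and has
  `μ(A₁) = 1 − 1/8 − 1/32 = 27/32`;
* `weights_witness_logVolume` — `(c/2)·log(8/9) + (c/3)·log(27/32) = −(c/6)·log 2`.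
[cite: MochizukiAbsTopIII2015, Prop. 5.7 (i)(a)(b) pp. 137–138] [cite: Mochizuki2012, IUTchIII Rmk. 3.9.5 (iv) p. 128]
Deliberately NOT here: hulls, the box model, any judgement on [IUTchIII] Cor. 3.12.
-/

noncomputable section

open MeasureTheory MeasureTheory.Measure Set Metric TopologicalSpace Bornology Filter
open scoped ENNReal NNReal Pointwise NormedField Topology
open Literature.NumberTheory.GaloisRepresentations.Ultrametric

namespace Literature.IUT.LogVolume

/-! ### One local field with residue field `𝔽₂`: the two factors -/

section OneField

variable (F : Type*) [NontriviallyNormedField F] [IsUltrametricDist F] [ProperSpace F]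

omit [IsUltrametricDist F] [ProperSpace F] in
/-- Norms of nonzero integers are natural powers of `‖ϖ‖`. [cite: MochizukiAbsTopIII2015, Prop. 5.7 (i)(a) p. 137] -/
theorem exists_norm_eq_pow_of_norm_le_one {ϖ : Fˣ} (hϖ : IsUniformizer ϖ) {x : F} (hx : x ≠ 0)
    (h1 : ‖x‖ ≤ 1) : ∃ n : ℕ, ‖x‖ = ‖(ϖ : F)‖ ^ n := by
  obtain ⟨k, hk⟩ := hϖ.2 (Units.mk0 x hx)
  rw [Units.val_mk0] at hk
  have hk0 : 0 ≤ k := by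
    rw [hk] at h1
    exact (zpow_le_one_iff_right_of_lt_one₀ (norm_units_pos ϖ) hϖ.norm_lt_one).mp h1
  obtain ⟨n, rfl⟩ := Int.eq_ofNat_of_zero_le hk0
  exact ⟨n, by rw [hk, zpow_natCast]⟩

omit [ProperSpace F] in
/-- The set `{‖x‖ = ‖ϖ‖ⁿ : n ≡ 3,4,5 (mod 6)}` removed from `O` is open (a union of spheres).
[cite: MochizukiAbsTopIII2015, Prop. 5.7 (i)(a) p. 137] -/
theorem isOpen_shells_mod_six (ϖ : Fˣ) :
    IsOpen {x : F | ∃ n : ℕ, ‖x‖ = ‖(ϖ : F)‖ ^ n ∧ 3 ≤ n % 6} := by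
  have : {x : F | ∃ n : ℕ, ‖x‖ = ‖(ϖ : F)‖ ^ n ∧ 3 ≤ n % 6} =
      ⋃ n : ℕ, sphere (0 : F) (‖(ϖ : F)‖ ^ n) ∩ {_x : F | 3 ≤ n % 6} := by
    ext x
    simp only [mem_setOf_eq, mem_iUnion, mem_inter_iff, mem_sphere_zero_iff_norm]
  rw [this]
  exact isOpen_iUnion fun n =>
    (IsUltrametricDist.isOpen_sphere _ (pow_ne_zero _ (norm_units_pos ϖ).ne')).inter isOpen_const

/-- The factor `A₀ = O ∖ {‖x‖ = ‖ϖ‖ⁿ : n ≡ 3,4,5 (mod 6)}` is compact and contains `1`.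
[cite: Mochizuki2012, IUTchIII Rmk. 3.9.5 (iv) p. 128] -/
theorem isCompact_selfSimilar_and_one_mem {ϖ : Fˣ} (hϖ : IsUniformizer ϖ) :
    IsCompact (closedBall (0 : F) 1 \ {x : F | ∃ n : ℕ, ‖x‖ = ‖(ϖ : F)‖ ^ n ∧ 3 ≤ n % 6}) ∧
      (1 : F) ∈ closedBall (0 : F) 1 \ {x : F | ∃ n : ℕ, ‖x‖ = ‖(ϖ : F)‖ ^ n ∧ 3 ≤ n % 6} := by
  refine ⟨(isCompact_closedBall (0 : F) 1).diff (isOpen_shells_mod_six F ϖ), ?_, ?_⟩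
  · simp
  · rintro ⟨n, hn, hn6⟩
    have hn0 : n ≠ 0 := by omega
    have : ‖(ϖ : F)‖ ^ n < 1 := pow_lt_one₀ (norm_nonneg _) hϖ.norm_lt_one hn0
    rw [← hn, norm_one] at this
    exact lt_irrefl _ this

variable [MeasurableSpace F] [BorelSpace F]

/-- Volumes of balls over the residue field `𝔽₂`: `μ(m^n) = 2^{-n}` (as a real number).
[cite: MochizukiAbsTopIII2015, Prop. 5.7 (i)(a) p. 137] -/
theorem localVolume_real_closedBall_pow_two {ϖ : Fˣ} (hϖ : IsUniformizer ϖ) (h2 : residueCard F = 2)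
    (n : ℕ) : (localVolume F (closedBall (0 : F) (‖(ϖ : F)‖ ^ n))).toReal = ((2 : ℝ) ^ n)⁻¹ := by
  have := localVolume_real_closedBall_zpow F hϖ (n : ℤ)
  rw [zpow_natCast, h2] at this
  rw [this, zpow_neg, zpow_natCast]
  norm_num

/-- **`μ(A₀) = 8/9`** by self-similarity: `A₀ = (O ∖ m³) ⊔ ϖ⁶·A₀`, so `μ(A₀) = 7/8 + μ(A₀)/64`.
[cite: Mochizuki2012, IUTchIII Rmk. 3.9.5 (iv) p. 128] [cite: MochizukiAbsTopIII2015, Prop. 5.7 (i)(b) p. 138] -/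
theorem localVolume_real_selfSimilar {ϖ : Fˣ} (hϖ : IsUniformizer ϖ) (h2 : residueCard F = 2) :
    (localVolume F (closedBall (0 : F) 1 \
      {x : F | ∃ n : ℕ, ‖x‖ = ‖(ϖ : F)‖ ^ n ∧ 3 ≤ n % 6})).toReal = 8 / 9 := by
  set U : Set F := {x : F | ∃ n : ℕ, ‖x‖ = ‖(ϖ : F)‖ ^ n ∧ 3 ≤ n % 6} with hUdef
  set A : Set F := closedBall (0 : F) 1 \ U with hAdef
  set D : Set F := closedBall (0 : F) 1 \ closedBall (0 : F) (‖(ϖ : F)‖ ^ 3) with hDdef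
  set u : Fˣ := ϖ ^ 6 with hudef
  have hϖ0 : 0 < ‖(ϖ : F)‖ := norm_units_pos ϖ
  have hϖ1 : ‖(ϖ : F)‖ < 1 := hϖ.norm_lt_one
  have hinj : Function.Injective fun n : ℕ => ‖(ϖ : F)‖ ^ n := pow_right_injective₀ hϖ0 hϖ1.ne
  have hu : (u : F) = (ϖ : F) ^ 6 := by rw [hudef, Units.val_pow_eq_pow_val]
  -- membership in `U` is decided by the exponent
  have hU : ∀ n : ℕ, ∀ x : F, ‖x‖ = ‖(ϖ : F)‖ ^ n → (x ∈ U ↔ 3 ≤ n % 6) := by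
    intro n x hx
    refine ⟨?_, fun h => ⟨n, hx, h⟩⟩
    rintro ⟨m, hm, hm6⟩
    rw [hx] at hm
    rw [hinj hm]
    exact hm6
  have h0U : (0 : F) ∉ U := by
    rintro ⟨n, hn, -⟩
    rw [norm_zero] at hn
    exact (pow_pos hϖ0 n).ne' hn.symm
  have h0A : (0 : F) ∈ A := ⟨by simp, h0U⟩
  -- the decomposition `A = D ∪ u • A`
  have hdec : A = D ∪ u • A := by
    ext x
    constructor
    · rintro ⟨hx1, hxU⟩
      rw [mem_closedBall_zero_iff] at hx1
      by_cases hx0 : x = 0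
      · subst hx0
        right
        rw [mem_smul_set_iff_inv_smul_mem, smul_zero]
        exact h0A
      obtain ⟨n, hn⟩ := exists_norm_eq_pow_of_norm_le_one F hϖ hx0 hx1
      by_cases hn3 : n < 3
      · left
        refine ⟨mem_closedBall_zero_iff.mpr hx1, fun h => ?_⟩
        rw [mem_closedBall_zero_iff, hn] at h
        exact absurd (pow_lt_pow_right_of_lt_one₀ hϖ0 hϖ1 hn3) (not_lt.mpr h)
      · right
        have hn6 : ¬ 3 ≤ n % 6 := fun h => hxU ((hU n x hn).mpr h)
        have hn6' : 6 ≤ n := by omega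
        rw [mem_smul_set_iff_inv_smul_mem]
        have hy : ‖u⁻¹ • x‖ = ‖(ϖ : F)‖ ^ (n - 6) := by
          rw [Units.smul_def, Units.val_inv_eq_inv_val, hu, smul_eq_mul, norm_mul, norm_inv, norm_pow,
            hn, mul_comm, ← pow_sub₀ _ hϖ0.ne' hn6']
        refine ⟨mem_closedBall_zero_iff.mpr (hy ▸ pow_le_one₀ hϖ0.le hϖ1.le), fun h => ?_⟩
        have := (hU (n - 6) _ hy).mp h
        omega
    · rintro (⟨hx1, hx3⟩ | hx)
      · rw [mem_closedBall_zero_iff] at hx1 hx3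
        refine ⟨mem_closedBall_zero_iff.mpr hx1, ?_⟩
        rintro ⟨n, hn, hn6⟩
        apply hx3
        rw [hn]
        exact pow_le_pow_of_le_one hϖ0.le hϖ1.le (by omega)
      · rw [mem_smul_set_iff_inv_smul_mem] at hx
        obtain ⟨hy1, hyU⟩ := hx
        rw [mem_closedBall_zero_iff] at hy1
        have hxy : x = (u : F) * (u⁻¹ • x) := by
          rw [Units.smul_def, smul_eq_mul, ← mul_assoc, Units.mul_inv, one_mul]
        have hnx : ‖x‖ = ‖(ϖ : F)‖ ^ 6 * ‖u⁻¹ • x‖ := by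
          rw [← norm_pow, ← hu, ← norm_mul, ← hxy]
        refine ⟨mem_closedBall_zero_iff.mpr ?_, ?_⟩
        · rw [hnx]
          exact mul_le_one₀ (pow_le_one₀ hϖ0.le hϖ1.le) (norm_nonneg _) hy1
        · rintro ⟨n, hn, hn6⟩
          by_cases hy0 : u⁻¹ • x = 0
          · rw [hnx, hy0, norm_zero, mul_zero] at hn
            exact (pow_pos hϖ0 n).ne' hn.symm
          obtain ⟨m, hm⟩ := exists_norm_eq_pow_of_norm_le_one F hϖ hy0 hy1
          rw [hnx, hm, ← pow_add] at hn
          have hnm : 6 + m = n := hinj hn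
          have := (hU m _ hm).not.mp hyU
          omega
  have hdisj : Disjoint D (u • A) := by
    rw [Set.disjoint_left]
    rintro x ⟨-, hx3⟩ hx
    rw [mem_smul_set_iff_inv_smul_mem] at hx
    obtain ⟨hy1, -⟩ := hx
    rw [mem_closedBall_zero_iff] at hy1 hx3
    apply hx3
    have hxy : x = (u : F) * (u⁻¹ • x) := by
      rw [Units.smul_def, smul_eq_mul, ← mul_assoc, Units.mul_inv, one_mul]
    rw [hxy, norm_mul, hu, norm_pow]
    calc ‖(ϖ : F)‖ ^ 6 * ‖u⁻¹ • x‖ ≤ ‖(ϖ : F)‖ ^ 6 * 1 :=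
          mul_le_mul_of_nonneg_left hy1 (pow_nonneg hϖ0.le _)
      _ ≤ ‖(ϖ : F)‖ ^ 3 := by rw [mul_one]; exact pow_le_pow_of_le_one hϖ0.le hϖ1.le (by omega)
  -- measures
  have hAc : IsCompact A := (isCompact_selfSimilar_and_one_mem F hϖ).1
  have hAm : MeasurableSet A := hAc.isClosed.measurableSet
  have hAfin : localVolume F A ≠ ∞ := (hAc.measure_lt_top).ne
  have hballfin : ∀ r : ℝ, localVolume F (closedBall (0 : F) r) ≠ ∞ := fun r =>
    ((isCompact_closedBall (0 : F) r).measure_lt_top).ne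
  have hD : (localVolume F D).toReal = 1 - ((2 : ℝ) ^ 3)⁻¹ := by
    rw [hDdef, measure_sdiff (closedBall_subset_closedBall (pow_le_one₀ hϖ0.le hϖ1.le))
      measurableSet_closedBall.nullMeasurableSet (hballfin _), ENNReal.toReal_sub_of_le
      (measure_mono (closedBall_subset_closedBall (pow_le_one₀ hϖ0.le hϖ1.le))) (hballfin _),
      localVolume_real_closedBall_pow_two F hϖ h2 3]
    have := localVolume_real_closedBall_pow_two F hϖ h2 0
    rw [pow_zero] at this
    rw [this]
    norm_num
  have hmod : ((distribHaarChar F u : ℝ≥0) : ℝ) = ((2 : ℝ) ^ 6)⁻¹ := by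
    rw [hudef, map_pow, NNReal.coe_pow, distribHaarChar_uniformizer_eq F hϖ, NNReal.coe_inv,
      NNReal.coe_natCast, h2, inv_pow]
    norm_num
  have huA : (localVolume F (u • A)).toReal = ((2 : ℝ) ^ 6)⁻¹ * (localVolume F A).toReal := by
    rw [localVolume_units_smul, ENNReal.toReal_mul, ENNReal.coe_toReal, hmod]
  have hDfin : localVolume F D ≠ ∞ := measure_ne_top_of_subset sdiff_subset (hballfin 1)
  have huAfin : localVolume F (u • A) ≠ ∞ := by
    rw [localVolume_units_smul]
    exact ENNReal.mul_ne_top ENNReal.coe_ne_top hAfin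
  have hsum : (localVolume F A).toReal = (localVolume F D).toReal + (localVolume F (u • A)).toReal := by
    conv_lhs => rw [hdec]
    rw [measure_union hdisj (hAm.const_smul _), ENNReal.toReal_add hDfin huAfin]
  rw [hD, huA] at hsum
  -- `a = 7/8 + a/64`
  linarith

/-- The factor `A₁ = O ∖ ({‖x‖ = ‖ϖ‖²} ∪ m⁵)`: compact, contains `1`, and **`μ(A₁) = 27/32`** over `𝔽₂`.
[cite: Mochizuki2012, IUTchIII Rmk. 3.9.5 (iv) p. 128] [cite: MochizukiAbsTopIII2015, Prop. 5.7 (i)(a) p. 137] -/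
theorem localVolume_real_puncturedBall {ϖ : Fˣ} (hϖ : IsUniformizer ϖ) (h2 : residueCard F = 2) :
    IsCompact (closedBall (0 : F) 1 \
        (sphere (0 : F) (‖(ϖ : F)‖ ^ 2) ∪ closedBall (0 : F) (‖(ϖ : F)‖ ^ 5))) ∧
      (1 : F) ∈ closedBall (0 : F) 1 \
        (sphere (0 : F) (‖(ϖ : F)‖ ^ 2) ∪ closedBall (0 : F) (‖(ϖ : F)‖ ^ 5)) ∧
      (localVolume F (closedBall (0 : F) 1 \
        (sphere (0 : F) (‖(ϖ : F)‖ ^ 2) ∪ closedBall (0 : F) (‖(ϖ : F)‖ ^ 5)))).toReal = 27 / 32 := by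
  have hϖ0 : 0 < ‖(ϖ : F)‖ := norm_units_pos ϖ
  have hϖ1 : ‖(ϖ : F)‖ < 1 := hϖ.norm_lt_one
  have hinj : Function.Injective fun n : ℕ => ‖(ϖ : F)‖ ^ n := pow_right_injective₀ hϖ0 hϖ1.ne
  refine ⟨(isCompact_closedBall (0 : F) 1).diff
    ((IsUltrametricDist.isOpen_sphere _ (pow_ne_zero _ hϖ0.ne')).union
      (IsUltrametricDist.isOpen_closedBall _ (pow_ne_zero _ hϖ0.ne'))), ?_, ?_⟩
  · refine ⟨by simp, ?_⟩
    rintro (h | h)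
    · rw [mem_sphere_zero_iff_norm, norm_one] at h
      exact (pow_lt_one₀ hϖ0.le hϖ1 (by norm_num)).ne h.symm
    · rw [mem_closedBall_zero_iff, norm_one] at h
      exact not_lt.mpr h (pow_lt_one₀ hϖ0.le hϖ1 (by norm_num))
  -- the sphere of radius `‖ϖ‖²` is `m² ∖ m³`
  have hsph : sphere (0 : F) (‖(ϖ : F)‖ ^ 2) =
      closedBall (0 : F) (‖(ϖ : F)‖ ^ 2) \ closedBall (0 : F) (‖(ϖ : F)‖ ^ 3) := by
    ext x
    simp only [mem_sphere_zero_iff_norm, Set.mem_sdiff, mem_closedBall_zero_iff, not_le]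
    constructor
    · intro h
      rw [h]
      exact ⟨le_rfl, pow_lt_pow_right_of_lt_one₀ hϖ0 hϖ1 (by norm_num)⟩
    · rintro ⟨h2le, h3lt⟩
      have hx0 : x ≠ 0 := fun h => by
        rw [h, norm_zero] at h3lt
        exact not_le.mpr h3lt (pow_nonneg hϖ0.le _)
      obtain ⟨n, hn⟩ := exists_norm_eq_pow_of_norm_le_one F hϖ hx0 (h2le.trans (pow_le_one₀ hϖ0.le hϖ1.le))
      rw [hn] at h2le h3lt ⊢
      have h2n : 2 ≤ n := by
        by_contra h
        exact not_lt.mpr h2le (pow_lt_pow_right_of_lt_one₀ hϖ0 hϖ1 (by omega))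
      have hn3 : n < 3 := by
        by_contra h
        exact not_le.mpr h3lt (pow_le_pow_of_le_one hϖ0.le hϖ1.le (by omega))
      have : n = 2 := by omega
      rw [this]
  have hballfin : ∀ r : ℝ, localVolume F (closedBall (0 : F) r) ≠ ∞ := fun r =>
    ((isCompact_closedBall (0 : F) r).measure_lt_top).ne
  have hball := localVolume_real_closedBall_pow_two F hϖ h2
  have hsphvol : (localVolume F (sphere (0 : F) (‖(ϖ : F)‖ ^ 2))).toReal = ((2 : ℝ) ^ 2)⁻¹ - ((2 : ℝ) ^ 3)⁻¹ := by
    have hsub : closedBall (0 : F) (‖(ϖ : F)‖ ^ 3) ⊆ closedBall (0 : F) (‖(ϖ : F)‖ ^ 2) :=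
      closedBall_subset_closedBall (pow_le_pow_of_le_one hϖ0.le hϖ1.le (by norm_num))
    rw [hsph, measure_sdiff hsub measurableSet_closedBall.nullMeasurableSet (hballfin _),
      ENNReal.toReal_sub_of_le (measure_mono hsub) (hballfin _), hball 2, hball 3]
  -- the removed set `R = sphere ∪ m⁵` and its volume `1/8 + 1/32`
  set R : Set F := sphere (0 : F) (‖(ϖ : F)‖ ^ 2) ∪ closedBall (0 : F) (‖(ϖ : F)‖ ^ 5) with hRdef
  have hRdisj : Disjoint (sphere (0 : F) (‖(ϖ : F)‖ ^ 2)) (closedBall (0 : F) (‖(ϖ : F)‖ ^ 5)) := by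
    rw [Set.disjoint_left]
    intro x hx h5
    rw [mem_sphere_zero_iff_norm] at hx
    rw [mem_closedBall_zero_iff, hx] at h5
    exact not_lt.mpr h5 (pow_lt_pow_right_of_lt_one₀ hϖ0 hϖ1 (by norm_num))
  have hRsub : R ⊆ closedBall (0 : F) 1 := by
    rintro x (hx | hx)
    · rw [mem_sphere_zero_iff_norm] at hx
      exact mem_closedBall_zero_iff.mpr (hx ▸ pow_le_one₀ hϖ0.le hϖ1.le)
    · exact closedBall_subset_closedBall (pow_le_one₀ hϖ0.le hϖ1.le) hx
  have hRfin : localVolume F R ≠ ∞ := measure_ne_top_of_subset hRsub (hballfin 1)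
  have hsphfin : localVolume F (sphere (0 : F) (‖(ϖ : F)‖ ^ 2)) ≠ ∞ :=
    measure_ne_top_of_subset subset_union_left hRfin
  have hRvol : (localVolume F R).toReal = ((2 : ℝ) ^ 2)⁻¹ - ((2 : ℝ) ^ 3)⁻¹ + ((2 : ℝ) ^ 5)⁻¹ := by
    rw [hRdef, measure_union hRdisj measurableSet_closedBall, ENNReal.toReal_add hsphfin (hballfin _),
      hsphvol, hball 5]
  have hRm : MeasurableSet R := (Metric.isClosed_sphere.measurableSet).union measurableSet_closedBall
  rw [measure_sdiff hRsub hRm.nullMeasurableSet hRfin,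
    ENNReal.toReal_sub_of_le (measure_mono hRsub) (hballfin 1), hRvol]
  have h1 := hball 0
  rw [pow_zero] at h1
  rw [h1]
  norm_num

end OneField

/-! ### Arithmetic of the weights -/

section Arithmetic

/-- Arithmetic of the witness: `(c/2)·log(8/9) + (c/3)·log(27/32) = −(c/6)·log 2`.
[cite: Mochizuki2012, IUTchIII Rmk. 3.9.5 (iv) p. 128] -/
theorem weights_witness_logVolume (c : ℝ) :
    c / 2 * Real.log (8 / 9) + c / 3 * Real.log (27 / 32) = -(c / 6) * Real.log 2 := by
  have h8 : Real.log (8 / 9 : ℝ) = 3 * Real.log 2 - 2 * Real.log 3 := by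
    rw [Real.log_div (by norm_num) (by norm_num), show (8 : ℝ) = 2 ^ 3 by norm_num,
      show (9 : ℝ) = 3 ^ 2 by norm_num, Real.log_pow, Real.log_pow]
    push_cast
    ring
  have h27 : Real.log (27 / 32 : ℝ) = 3 * Real.log 3 - 5 * Real.log 2 := by
    rw [Real.log_div (by norm_num) (by norm_num), show (27 : ℝ) = 3 ^ 3 by norm_num,
      show (32 : ℝ) = 2 ^ 5 by norm_num, Real.log_pow, Real.log_pow]
    push_cast
    ring
  rw [h8, h27]
  ring

end Arithmetic

end Literature.IUT.LogVolume

end
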